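import Mathlib
import Summits.ResolutionOfSingularities.ResolutionOfSingularities.Theorems.SyzygyFlatteningHigherRankTerminationNormIdealIndep
import Summits.ResolutionOfSingularities.ResolutionOfSingularities.Theorems.SyzygyFlatteningHigherRankTerminationBaseChangedDatum
import Literature.AlgebraicGeometry.Resolution.ModuleBlowup
import Literature.AlgebraicGeometry.Resolution.SyzygySheaf
import HarnessLib

/-!
# Norm ideals of syzygy data agree up to scalars under flat base change — `stub_syzygyDatumCompat`

Crux `SyzygyFlattening.Globalisation` (stmt-ResolutionOfSingularities-17061), line `birth`,
registered stub `stub_syzygyDatumCompat` (pure commutative algebra).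

Let `f : R → S` be an injective flat ring map of noetherian domains, `J ⊆ R` an ideal, `e : ℕ`.
A *syzygy norm ideal datum* for `(R, e, J)` is a finite free resolution `F` of `R ⧸ J`
(`FreeResolution`), an injective framing `φ : F.syzygy e → R^r` (`IsFraming`) and its ideal of
maximal minors `N = normIdeal φ`; likewise `(F', φ', N')` for `(S, e, J S)`. The stub:
`a · N' = b · (N S)` for some non-zero `a, b ∈ S` — Villamayor's "`[[Ωₑ]]` is a well defined
fractional ideal class, compatible with flat base change" (Villamayor 2006, (2.0.1) and 3.4).

Proof (everything is in the tree):
* `baseChangedDatum_alg` (`…HigherRankTerminationBaseChangedDatum.lean`): along the flat injective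
  `R → S` the matrices of `F` resolve `S ⧸ J S` (`FreeResolution.baseChange`, the quotient being a
  base change), the syzygy module base-changes and `φ` extends to an injective `φ_S = φ ⊗ S` with
  torsion cokernel, `φ_S ∘ (Ω → Ω_S) = f ∘ φ` entrywise, and every maximal minor of `φ_S` lies in
  `N S`; with the converse inclusion (compatibility) `normIdeal φ_S = N S`.
* `stub_normIdeal_indep` (`…HigherRankTerminationNormIdealIndep.lean`) over `S` inside
  `L = Frac S`: the `S`-spans of the `L`-valued minors of `φ'` and of `φ_S` — the images of `N'`
  and `N S` in `L` — differ by one constant `c = p / q ∈ Lˣ`; clearing the denominator and pulling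
  back along the injective `S → L` gives `q · N' = p · N S`.
-/

noncomputable section

-- single-problem summit: the doubled namespace component `ResolutionOfSingularities` is forced
set_option linter.dupNamespace false

namespace Summit.ResolutionOfSingularities.ResolutionOfSingularities.Theorems.SyzygyFlattening

open Function Literature.AlgebraicGeometry.Resolution

/-! ## Two bookkeeping lemmas in a ring extension `S → L` -/

/-- The `S`-span in `L` of the `L`-valued maximal minors of `ι : M → S^r` is the image in `L` of
the norm ideal `[[M]]_ι` (`algebraMap` commutes with `det`). [folklore] -/
theorem span_det_algebraMap_eq_map_normIdeal {S L : Type*} [CommRing S] [CommRing L]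
    [Algebra S L] {M : Type*} [AddCommGroup M] [Module S M] {r : ℕ} (ι : M →ₗ[S] (Fin r → S)) :
    Submodule.span S (Set.range fun g : Fin r → M =>
        Matrix.det (Matrix.of fun i j => algebraMap S L (ι (g i) j))) =
      Submodule.map (Algebra.linearMap S L) (normIdeal ι) := by
  have h : (fun g : Fin r → M => Matrix.det (Matrix.of fun i j => algebraMap S L (ι (g i) j))) =
      Algebra.linearMap S L ∘ fun g => (frameMatrix ι g).det := by
    funext g
    rw [Function.comp_apply, Algebra.linearMap_apply]
    exact (ringHom_det_of (algebraMap S L) fun i j => ι (g i) j).symm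
  rw [normIdeal_eq_span, ← Ideal.submodule_span_eq, Submodule.map_span, ← Set.range_comp, ← h]

/-- Scaling an ideal by `s` and passing to `L` is scaling its image in `L` by the image of `s`:
`(s · I) L = s · (I L)` as `S`-submodules of `L`. [folklore] -/
theorem map_linearMap_span_singleton_mul {S L : Type*} [CommRing S] [CommRing L] [Algebra S L]
    (s : S) (I : Ideal S) :
    Submodule.map (Algebra.linearMap S L) (Ideal.span {s} * I) =
      (Submodule.map (Algebra.linearMap S L) I).map (LinearMap.mulLeft S (algebraMap S L s)) := by
  ext x
  simp only [Submodule.mem_map, Ideal.mem_span_singleton_mul, Algebra.linearMap_apply,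
    LinearMap.mulLeft_apply]
  constructor
  · rintro ⟨y, ⟨z, hz, rfl⟩, rfl⟩
    exact ⟨algebraMap S L z, ⟨z, hz, rfl⟩, by rw [map_mul]⟩
  · rintro ⟨y, ⟨z, hz, rfl⟩, rfl⟩
    exact ⟨s * z, ⟨z, hz, rfl⟩, by rw [map_mul]⟩

/-! ## The registered stub -/

/-- **STUB `stub_syzygyDatumCompat` (pure commutative algebra).** Along a flat injective ring map
`f : R → S` of Noetherian domains, two syzygy norm ideal datums — one for `R ⧸ J` over `R`, one for
`S ⧸ JS` over `S`, same index — have norm ideals that agree up to non-zero scalars: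
`a · N_S = b · N_R S`. Proof: base-change the `R`-datum along `f` (`baseChangedDatum_alg`:
`FreeResolution.baseChange`, `isBaseChange_syzygyMap`, the framing `φ ⊗ S` stays injective with
torsion cokernel and its norm ideal becomes `N_R S`, `normIdeal_eq_map_of_span_eq_top`), then compare
with the `S`-datum by `stub_normIdeal_indep` inside `Frac S` (Schanuel + free summands + embeddings,
landed) and clear the denominator of the constant. [cite: Villamayoru2006, (2.0.1) and 3.4] -/
theorem stub_syzygyDatumCompat : ∀ (R S : Type) [CommRing R] [IsDomain R] [IsNoetherianRing R]
    [CommRing S] [IsDomain S] [IsNoetherianRing S] (f : R →+* S), Function.Injective f → f.Flat →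
      ∀ (J : Ideal R) (e : ℕ) (N : Ideal R) (N' : Ideal S),
        (∃ (F : FreeResolution R (R ⧸ J)) (r : ℕ) (φ : ↥(F.syzygy e) →ₗ[R] (Fin r → R)),
          Function.Injective φ ∧ IsFraming φ ∧ N = normIdeal φ) →
        (∃ (F' : FreeResolution S (S ⧸ J.map f)) (r' : ℕ) (φ' : ↥(F'.syzygy e) →ₗ[S] (Fin r' → S)),
          Function.Injective φ' ∧ IsFraming φ' ∧ N' = normIdeal φ') →
        ∃ a b : S, a ≠ 0 ∧ b ≠ 0 ∧ Ideal.span {a} * N' = Ideal.span {b} * N.map f := by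
  intro R S _ _ _ _ _ _ f hf hflat J e N N' ⟨F, r, φ, hφ, hφfr, hN⟩ ⟨F', r', φ', hφ', hφ'fr, hN'⟩
  -- (0) `S` as a flat `R`-algebra along the injective `f`
  letI : Algebra R S := f.toAlgebra
  haveI : Module.Flat R S := hflat
  have hRS : Function.Injective (algebraMap R S) := hf
  -- torsion cokernels with non-zero multipliers (domains)
  have htors : ∀ z : Fin r → R, ∃ a : R, a ≠ 0 ∧ a • z ∈ LinearMap.range φ := fun z => by
    obtain ⟨a, ha, h⟩ := hφfr.exists_smul_mem z
    exact ⟨a, nonZeroDivisors.ne_zero ha, h⟩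
  have htors' : ∀ z : Fin r' → S, ∃ a : S, a ≠ 0 ∧ a • z ∈ LinearMap.range φ' := fun z => by
    obtain ⟨a, ha, h⟩ := hφ'fr.exists_smul_mem z
    exact ⟨a, nonZeroDivisors.ne_zero ha, h⟩
  -- (1)–(3) base change of the `R`-datum along `f`: resolution, syzygy module, framing
  obtain ⟨d₁, ε₁, ι₁, g, ⟨hε₁, h0₁, hs₁, hι₁, htors₁⟩, happ, hminor⟩ :=
    baseChangedDatum_alg hRS J (J.map f) rfl e F.rank F.d F.ε r φ F.ε_surjective F.exact_zero
      F.exact_succ hφ htors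
  have happ' : ∀ m : ↥(LinearMap.range (F.d e)), ι₁ (g m) = algebraMap R S ∘ φ m :=
    fun m => funext (happ m)
  -- the norm ideal of the base-changed framing is `N S`
  have hnorm : normIdeal ι₁ = N.map f := by
    rw [hN]
    apply le_antisymm
    · have hle : Ideal.span (Set.range fun g₀ : Fin r → ↥(LinearMap.range (F.d e)) =>
          algebraMap R S (Matrix.det (Matrix.of fun i j => φ (g₀ i) j))) ≤ (normIdeal φ).map f :=
        Ideal.span_le.2 (by
          rintro _ ⟨g₀, rfl⟩
          exact Ideal.mem_map_of_mem f (det_mem_normIdeal φ g₀))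
      rw [normIdeal, Ideal.span_le]
      rintro _ ⟨g', rfl⟩
      exact hle (hminor g')
    · rw [Ideal.map_le_iff_le_comap, normIdeal, Ideal.span_le]
      rintro _ ⟨g₀, rfl⟩
      rw [SetLike.mem_coe, Ideal.mem_comap]
      change algebraMap R S (frameMatrix φ g₀).det ∈ normIdeal ι₁
      rw [← det_frameMatrix_comp g φ ι₁ happ' g₀]
      exact det_mem_normIdeal ι₁ _
  -- (4) compare the two `S`-data inside `L = Frac S`
  obtain ⟨c, hc, hspan⟩ := stub_normIdeal_indep S (FractionRing S)
    (IsFractionRing.injective S (FractionRing S)) (S ⧸ J.map f) F.rank d₁ ε₁ F'.rank F'.d F'.ε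
    hε₁ h0₁ hs₁ F'.ε_surjective F'.exact_zero F'.exact_succ e r r' ι₁ φ' hι₁ hφ' htors₁ htors'
  rw [span_det_algebraMap_eq_map_normIdeal, span_det_algebraMap_eq_map_normIdeal, hnorm,
    ← hN'] at hspan
  -- `c = p / q` with `p, q ∈ S` non-zero
  obtain ⟨p, q, hq, hpq⟩ := IsFractionRing.div_surjective (A := S) c
  have hq0 : algebraMap S (FractionRing S) q ≠ 0 :=
    IsFractionRing.to_map_ne_zero_of_mem_nonZeroDivisors hq
  refine ⟨q, p, nonZeroDivisors.ne_zero hq, ?_, ?_⟩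
  · rintro rfl
    apply hc
    rw [← hpq, map_zero, zero_div]
  · apply Submodule.map_injective_of_injective (f := Algebra.linearMap S (FractionRing S))
      (IsFractionRing.injective S (FractionRing S))
    rw [map_linearMap_span_singleton_mul, map_linearMap_span_singleton_mul, hspan,
      ← Submodule.map_comp, ← LinearMap.mulLeft_mul, ← hpq, mul_div_cancel₀ _ hq0]

end Summit.ResolutionOfSingularities.ResolutionOfSingularities.Theorems.SyzygyFlattening

end
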